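import Summits.HubbardSuperconductivity.HubbardSuperconductivity.Theorems.WidthHaldaneDirichletRatioBounds
import Summits.HubbardSuperconductivity.HubbardSuperconductivity.Theorems.WidthHaldaneTubeFreeKineticNumber
import Summits.HubbardSuperconductivity.HubbardSuperconductivity.Theorems.WidthHaldaneTubeLandauLocalisation

/-!
# The kinetic floor of the Landau line with a width-uniform constant

Support file for the tube cruxes stated over `WidthHaldaneDefs` (routes `WidthHaldane`,
`SeamInduction`; items stmt-HubbardSuperconductivity-16311/16312/18509/18510), all PROVED, no
definitions, no named facts. Crux idea `landau-window-yrast` (crux `WidthUniformThermodynamics`)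
reduces the width-uniform stiffness floor to (i) a KINETIC FLOOR `k'·LM ≤ K(ψ)` on the `O(M/L)`
energy window of the untwisted sector and (ii) a Landau criterion there
(`stiffnessOfLandauCriterion`, `tubeStiffness_ge_of_landauWindow`). Hypothesis (i) was proved with
an explicit but SIZE-DEPENDENT constant in `WidthHaldaneTubeFreeKineticNumber`
(`kineticFloor_window_closedForm`). Here the discrete parameters are chosen
(`WidthHaldaneDirichletRatioBounds`: blocks `2m₁+1 ∈ [αL-2, αL]`, `2m₂+1 ∈ [βM-2, βM]`, dual level
`2m-1 ∈ [νM-2, νM]`, two-sided Dirichlet-ratio bounds, `closedForm_ge_core`) and (i) is proved in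
the quantifier shape of the crux, `∃ M₁ ∀ M₁ ≤ M ≤ L`, with a constant that does not depend on the
size:

* **`exists_kineticFloor_uniform`** — for `δ ∈ [0,1)` (`ν = (1-δ)/2`), box fractions
  `α, β ∈ (0,1]` with `αβ ≤ ν`, `ε > 0`, `w ≥ 0`: `∃ M₁ ∀ U ≥ 0 ∀ M₁ ≤ M ≤ L ∀ labellings`, every
  unit vector `ψ` of `(N_{L,M}(δ), 0)` with `Re⟨ψ,H₀ψ⟩ - E(0) ≤ wM/L` has `(k₀ - Uν - ε)·LM ≤ K(ψ)`,
  `k₀ = (4/π)(β sin πα + α sin πβ) - 8(ν - αβ) - (4/π) sin πν`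
  (`M₁ = ⌈(69+w)/ε⌉ + ⌈2/α⌉ + ⌈2/β⌉ + ⌈2/(1-δ)⌉ + 3`; Fermi sets from `exists_fermiSet`);
* `sin_two_pi_div_five_sq` (`= (5+√5)/8`), `sin_two_pi_div_five_le` (`≤ 0.9511`),
  `kineticConstant_fifth_ge` — at `δ = 1/5` the box `(2/3, 3/5)` gives
  `k₀ = (4/π)(3√3/10 - sin(2π/5)/3) ≥ 1/4`;
* **`exists_kineticFloor_uniform_fifth`** — hence `KineticFloorAt` with `k' = 1/4 - 2U/5 - ε` at
  `δ = 1/5`, uniformly in `M₁ ≤ M ≤ L` (positive for `U < 5/8`; the optimal box `α = β = √ν` would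
  give `0.26`, the true free value is `≈ 0.76`; the interaction is charged `Uν` through the crude
  doublon bound `⟨D⟩ ≤ N/2` of `WidthHaldaneTubeKineticWindow`).

* **`uniform_stiffnessFloor_fifth_of_landauWindow`** — the composition with the landed reduction
  `tubeStiffness_ge_of_landauWindow`: IF the ★ window Landau criterion holds at
  `(U, 1/5, κ, s, w)` for all `M₀ ≤ M ≤ L` and all labellings, THEN
  `∃ M₁ ∀ M₁ ≤ M ≤ L ∀ labellings, 1/4 - 2U/5 - κ - 2ε ≤ ρ̃_{L,M}(U, 1/5)` — conjunct (i) of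
  `WidthUniformThermodynamics` at `δ = 1/5` in the crux's own quantifier shape, with the ★ stub as
  its ONLY hypothesis.

After this file the Landau line of the crux is, in the tree, exactly its ★ stub (the Landau
criterion on the window, uniformly in the width). [cite: ScalapinoWhiteZhang1993, §II]
-/

noncomputable section

namespace Summit.HubbardSuperconductivity.HubbardSuperconductivity.Theorems.WidthHaldane

set_option linter.dupNamespace false -- summit = problem name (single-conjunct summit), D-0017

open scoped BigOperators Classical
open Literature.MathematicalPhysics.QuantumLattice

/-! ### The kinetic floor with a WIDTH-UNIFORM constant -/

section Uniform

open Matrix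

/-- **KINETIC FLOOR ON THE WINDOW, UNIFORMLY IN THE WIDTH.** Fix a doping `δ ∈ [0, 1)`
(`ν = (1-δ)/2` the filling per spin and site), box fractions `α, β ∈ (0, 1]` with `αβ ≤ ν`, a
tolerance `ε > 0` and a window constant `w ≥ 0`. Then there is a width threshold `M₁` such that for
ALL `U ≥ 0`, all sizes `M₁ ≤ M ≤ L` and all labellings, every unit vector `ψ` of the untwisted
sector `(N_{L,M}(δ), 0)` in the window `Re⟨ψ,H₀ψ⟩ - E(0) ≤ wM/L` has longitudinal kinetic form
`K(ψ) ≥ k'·LM` with the EXPLICIT, SIZE-INDEPENDENT constant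
`k' = (4/π)(β sin πα + α sin πβ) - 8(ν - αβ) - (4/π) sin πν - Uν - ε`
— the hypothesis `KineticFloorAt` of the Landau reductions (`stiffnessOfLandauCriterion`,
`tubeStiffness_ge_of_landauWindow`) in the crux's quantifier shape `∃ M₁ ∀ M₁ ≤ M ≤ L`. Proof:
`kineticFloor_window_closedForm` at the blocks `2m₁+1 ∈ [αL-2, αL]`, `2m₂+1 ∈ [βM-2, βM]` and the
dual level `2m-1 ∈ [νM-2, νM]`, the two Dirichlet-ratio bounds, and the budget
`M₁ = ⌈(69+w)/ε⌉ + ⌈2/α⌉ + ⌈2/β⌉ + ⌈2/(1-δ)⌉ + 3` absorbing all `O(1/L + 1/M)` losses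
(`closedForm_ge_core`). At `αβ = ν`, `α = β = √ν` the constant is `(8/π)√ν sin(π√ν) - (4/π) sin πν - Uν - ε`
(`0.26 - 0.4U - ε` at `δ = 1/5`). [cite: ScalapinoWhiteZhang1993, §II] -/
theorem exists_kineticFloor_uniform {δ α β ε : ℝ} (w : ℝ) (hδ0 : 0 ≤ δ) (hδ1 : δ < 1)
    (hα0 : 0 < α) (hα1 : α ≤ 1) (hβ0 : 0 < β) (hβ1 : β ≤ 1) (hαβ : α * β ≤ (1 - δ) / 2)
    (hε : 0 < ε) (hw : 0 ≤ w) :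
    ∃ M₁ : ℕ, ∀ (L M : ℕ) [NeZero L] [NeZero M] (Λ : Type) [LinearOrder Λ] [Fintype Λ]
      (e : Λ ≃ ZMod L × ZMod M) (U : ℝ), 0 ≤ U → M₁ ≤ M → M ≤ L →
      ∀ ψ ∈ szSector (Λ := Λ) (tubeFilling L M δ) 0, star ψ ⬝ᵥ ψ = (1 : ℂ) →
        (expect (tubeH0 L M Λ e U) ψ).re - tubeEnergy L M Λ e U 0 (tubeFilling L M δ) ≤ w * M / L →
          (4 / Real.pi * (β * Real.sin (Real.pi * α) + α * Real.sin (Real.pi * β)) -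
              8 * ((1 - δ) / 2 - α * β) - 4 / Real.pi * Real.sin (Real.pi * ((1 - δ) / 2)) -
              U * ((1 - δ) / 2) - ε) * ((L : ℝ) * M) ≤
            ∑ a : ZMod L, ∑ b : ZMod M, ∑ σ : Fin 2,
              (expect (creation (orb (e.symm (a, b)) σ) * annihilation (orb (e.symm (a - 1, b)) σ) +
                creation (orb (e.symm (a - 1, b)) σ) * annihilation (orb (e.symm (a, b)) σ)) ψ).re := by
  have hν0 : 0 < (1 - δ) / 2 := by linarith
  have hνh : (1 - δ) / 2 ≤ 1 / 2 := by linarith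
  refine ⟨⌈(69 + w) / ε⌉₊ + ⌈2 / α⌉₊ + ⌈2 / β⌉₊ + ⌈2 / (1 - δ)⌉₊ + 3, ?_⟩
  intro L M _ _ Λ _ _ e U hU hM₁ hML
  -- unpack the threshold
  have hM3 : 3 ≤ M := le_trans (by omega) hM₁
  have hL3 : 3 ≤ L := hM3.trans hML
  have hMr : ((⌈(69 + w) / ε⌉₊ + ⌈2 / α⌉₊ + ⌈2 / β⌉₊ + ⌈2 / (1 - δ)⌉₊ + 3 : ℕ) : ℝ) ≤ M := by
    exact_mod_cast hM₁
  push_cast at hMr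
  have hc1 := Nat.le_ceil ((69 + w) / ε)
  have hc2 := Nat.le_ceil (2 / α)
  have hc3 := Nat.le_ceil (2 / β)
  have hc4 := Nat.le_ceil (2 / (1 - δ))
  have hg1 : (0 : ℝ) ≤ ⌈(69 + w) / ε⌉₊ := Nat.cast_nonneg _
  have hg2 : (0 : ℝ) ≤ ⌈2 / α⌉₊ := Nat.cast_nonneg _
  have hg3 : (0 : ℝ) ≤ ⌈2 / β⌉₊ := Nat.cast_nonneg _
  have hg4 : (0 : ℝ) ≤ ⌈2 / (1 - δ)⌉₊ := Nat.cast_nonneg _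
  have hMLr : (M : ℝ) ≤ L := by exact_mod_cast hML
  have hM1r : (1 : ℝ) ≤ M := by linarith
  have hεM : 69 + w ≤ ε * M := by
    have h := (div_le_iff₀ hε).1 (show (69 + w) / ε ≤ M by linarith)
    linarith
  have hαL : 2 ≤ α * L := by
    have h := (div_le_iff₀ hα0).1 (show 2 / α ≤ L by linarith)
    linarith
  have hβM : 2 ≤ β * M := by
    have h := (div_le_iff₀ hβ0).1 (show 2 / β ≤ M by linarith)
    linarith
  have hνM : 1 ≤ (1 - δ) / 2 * M := by
    have h := (div_le_iff₀ (by linarith : (0 : ℝ) < 1 - δ)).1 (show 2 / (1 - δ) ≤ M by linarith)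
    linarith
  -- blocks and the dual level
  obtain ⟨m₁, h₁, hp', hp⟩ := exists_odd_block_near (N := L) hα1 (by linarith : 1 ≤ α * L)
  obtain ⟨m₂, h₂, hq', hq⟩ := exists_odd_block_near (N := M) hβ1 (by linarith : 1 ≤ β * M)
  obtain ⟨m, hm1, hm, htle, htge, htcast⟩ := exists_dual_level (M := M) hνh hνM (le_trans (by norm_num) hM3)
  -- Fermi sets of `n = N/2` transverse / full levels
  have hn_le : ⌊(1 - δ) * ((L : ℝ) * (M : ℝ)) / 2⌋₊ ≤ L * M := half_tubeFilling_le L M (by linarith)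
  have hcardι : Fintype.card (ZMod L × ZMod M) = L * M := by
    rw [Fintype.card_prod, ZMod.card, ZMod.card]
  obtain ⟨Ft, μt, hcardt, hFt, hFt'⟩ := exists_fermiSet
    (fun k : ZMod L × ZMod M => -2 * Real.cos (2 * Real.pi * (k.2.val : ℝ) / M))
    (n := ⌊(1 - δ) * ((L : ℝ) * (M : ℝ)) / 2⌋₊) (by rw [hcardι]; exact hn_le)
  obtain ⟨F, μ, hcard, hF, hF'⟩ := exists_fermiSet (tubeBand L M)
    (n := ⌊(1 - δ) * ((L : ℝ) * (M : ℝ)) / 2⌋₊) (by rw [hcardι]; exact hn_le)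
  -- the floor `n` against `νLM`
  have hLM0 : (0 : ℝ) ≤ (L : ℝ) * M := by positivity
  have hnr0 : 0 ≤ (1 - δ) * ((L : ℝ) * (M : ℝ)) / 2 := by
    have : 0 ≤ 1 - δ := by linarith
    positivity
  have hnr : (⌊(1 - δ) * ((L : ℝ) * (M : ℝ)) / 2⌋₊ : ℝ) ≤ (1 - δ) / 2 * ((L : ℝ) * M) := by
    have := Nat.floor_le hnr0
    linarith
  -- the admissibility of the discrete parameters
  have hp_box : (2 * m₁ + 1) * (2 * m₂ + 1) ≤ ⌊(1 - δ) * ((L : ℝ) * (M : ℝ)) / 2⌋₊ := by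
    apply Nat.le_floor
    push_cast
    have hαL0 : 0 ≤ α * L := by positivity
    calc (2 * (m₁ : ℝ) + 1) * (2 * (m₂ : ℝ) + 1) ≤ (α * L) * (β * M) :=
          mul_le_mul hp' hq' (by positivity) hαL0
      _ = (α * β) * ((L : ℝ) * M) := by ring
      _ ≤ (1 - δ) / 2 * ((L : ℝ) * M) := mul_le_mul_of_nonneg_right hαβ hLM0
      _ = (1 - δ) * ((L : ℝ) * (M : ℝ)) / 2 := by ring
  have hmn : (2 * m - 1) * L ≤ ⌊(1 - δ) * ((L : ℝ) * (M : ℝ)) / 2⌋₊ := by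
    apply Nat.le_floor
    rw [Nat.cast_mul, htcast]
    have hL0 : (0 : ℝ) ≤ L := Nat.cast_nonneg L
    calc (2 * ((m - 1 : ℕ) : ℝ) + 1) * L ≤ ((1 - δ) / 2 * M) * L :=
          mul_le_mul_of_nonneg_right htle hL0
      _ = (1 - δ) * ((L : ℝ) * (M : ℝ)) / 2 := by ring
  -- the two Dirichlet-ratio bounds and the sines
  have hL2 : 2 ≤ L := le_trans (by norm_num) hL3
  have hM2 : 2 ≤ M := le_trans (by norm_num) hM3
  have hS₁ := dirichletRatio_ge_of_near (N := L) hL2 h₁ hp hp'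
  have hS₂ := dirichletRatio_ge_of_near (N := M) hM2 h₂ hq hq'
  have ht0 : 0 ≤ 2 * ((m - 1 : ℕ) : ℝ) + 1 := by positivity
  have hSt := dirichletRatio_le_of_le (M := M) hM3 ht0 htle hνh
  have hπ := Real.pi_pos
  have hsa0 : 0 ≤ Real.sin (Real.pi * α) :=
    Real.sin_nonneg_of_nonneg_of_le_pi (by positivity) (mul_le_of_le_one_right hπ.le hα1)
  have hsb0 : 0 ≤ Real.sin (Real.pi * β) :=
    Real.sin_nonneg_of_nonneg_of_le_pi (by positivity) (mul_le_of_le_one_right hπ.le hβ1)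
  have hcπ : 1 / Real.pi ≤ 1 / 3 :=
    div_le_div_of_nonneg_left zero_le_one (by norm_num) Real.pi_gt_three.le
  have hiM : 1 / (M : ℝ) ≤ 1 := by
    rw [div_le_one (by linarith)]
    exact hM1r
  have hwML : w * M / L ≤ w := by
    rw [mul_div_assoc]
    have : (M : ℝ) / L ≤ 1 := by rw [div_le_one (by linarith)]; exact hMLr
    exact mul_le_of_le_one_right hw this
  -- the core inequality
  have key := closedForm_ge_core (U := U) (ε := ε) (w := w) (ν := (1 - δ) / 2)
    (c := 1 / Real.pi) (iM := 1 / M) (wML := w * M / L)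
    (n := (⌊(1 - δ) * ((L : ℝ) * (M : ℝ)) / 2⌋₊ : ℝ)) (t := ((2 * m - 1 : ℕ) : ℝ))
    (S₁ := Real.sin ((2 * (m₁ : ℝ) + 1) * Real.pi / L) / Real.sin (Real.pi / L))
    (S₂ := Real.sin ((2 * (m₂ : ℝ) + 1) * Real.pi / M) / Real.sin (Real.pi / M))
    (St := Real.sin ((2 * ((m - 1 : ℕ) : ℝ) + 1) * Real.pi / M) / Real.sin (Real.pi / M))
    hM1r hMLr hα1 hβ1 hαL hβM hp hp' hq hq' (by rw [htcast]; exact htge) hnr hsa0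
    (Real.sin_le_one _) hsb0 (Real.sin_le_one _) (by positivity) hcπ hiM hS₁ hS₂ hSt hU hw hwML hεM
  have e4 : (4 : ℝ) / Real.pi = 4 * (1 / Real.pi) := by ring
  -- plug into the closed form
  intro ψ hψ hψ1 hwin
  refine kineticFloor_window_closedForm L M Λ e hL3 hM3 U hU (by linarith) Ft F μt μ hFt hFt' hF hF'
    hcardt hcard hm1 hm hmn h₁ h₂ hp_box w _ ?_ ψ hψ hψ1 hwin
  rw [e4]
  exact key

end Uniform

/-! ### The constant at `δ = 1/5`: `k' = 1/4 - 2U/5 - ε` -/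

section Fifth

open Matrix

/-- `sin²(2π/5) = (5 + √5)/8` (from `cos(π/5) = (1 + √5)/4`). [folklore] -/
theorem sin_two_pi_div_five_sq : Real.sin (2 * Real.pi / 5) ^ 2 = (5 + Real.sqrt 5) / 8 := by
  have h5 : Real.sqrt 5 ^ 2 = 5 := Real.sq_sqrt (by norm_num)
  rw [show 2 * Real.pi / 5 = 2 * (Real.pi / 5) by ring, Real.sin_two_mul, mul_pow, mul_pow,
    Real.sin_sq, Real.cos_pi_div_five]
  linear_combination ((-(Real.sqrt 5) ^ 2 - 4 * Real.sqrt 5 + 5) / 64) * h5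

/-- `sin(2π/5) ≤ 0.9511`. [folklore] -/
theorem sin_two_pi_div_five_le : Real.sin (2 * Real.pi / 5) ≤ 0.9511 := by
  have hsq := sin_two_pi_div_five_sq
  have h5 : Real.sqrt 5 ≤ 2.2361 := by
    rw [show (2.2361 : ℝ) = Real.sqrt (2.2361 ^ 2) from (Real.sqrt_sq (by norm_num)).symm]
    exact Real.sqrt_le_sqrt (by norm_num)
  have hs0 : 0 ≤ Real.sin (2 * Real.pi / 5) :=
    Real.sin_nonneg_of_nonneg_of_le_pi (by positivity) (by linarith [Real.pi_pos])
  nlinarith [hsq, h5, hs0]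

/-- **The width-uniform kinetic constant at `δ = 1/5` with the box `(α, β) = (2/3, 3/5)`** is at
least `1/4`: `(4/π)((3/5) sin(2π/3) + (2/3) sin(3π/5)) - (4/π) sin(2π/5) = (4/π)(3√3/10 - sin(2π/5)/3) ≥ 1/4`
(`sin(2π/3) = √3/2`, `sin(3π/5) = sin(2π/5) ≤ 0.9511`, `π ≤ 3.1416`). [folklore] -/
theorem kineticConstant_fifth_ge :
    (1 : ℝ) / 4 ≤ 4 / Real.pi * (3 / 5 * Real.sin (Real.pi * (2 / 3)) + 2 / 3 * Real.sin (Real.pi * (3 / 5))) -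
      8 * ((1 - 1 / 5) / 2 - 2 / 3 * (3 / 5)) - 4 / Real.pi * Real.sin (Real.pi * ((1 - 1 / 5) / 2)) := by
  have hπ0 := Real.pi_pos
  have hπ4 : Real.pi < 3.1416 := Real.pi_lt_d4
  have h1 : Real.sin (Real.pi * (2 / 3)) = Real.sqrt 3 / 2 := by
    rw [show Real.pi * (2 / 3) = Real.pi - Real.pi / 3 by ring, Real.sin_pi_sub, Real.sin_pi_div_three]
  have h2 : Real.sin (Real.pi * (3 / 5)) = Real.sin (2 * Real.pi / 5) := by
    rw [show Real.pi * (3 / 5) = Real.pi - 2 * Real.pi / 5 by ring, Real.sin_pi_sub]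
  have h3 : Real.sin (Real.pi * ((1 - 1 / 5) / 2)) = Real.sin (2 * Real.pi / 5) := by
    congr 1; ring
  have hs := sin_two_pi_div_five_le
  have h3r : (1.732 : ℝ) ≤ Real.sqrt 3 := by
    rw [Real.le_sqrt (by norm_num)] <;> norm_num
  rw [h1, h2, h3]
  rw [show 4 / Real.pi * (3 / 5 * (Real.sqrt 3 / 2) + 2 / 3 * Real.sin (2 * Real.pi / 5)) -
      8 * ((1 - 1 / 5) / 2 - 2 / 3 * (3 / 5)) - 4 / Real.pi * Real.sin (2 * Real.pi / 5) =
      (4 * (3 * Real.sqrt 3 / 10 - Real.sin (2 * Real.pi / 5) / 3)) / Real.pi by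
    field_simp; ring]
  rw [le_div_iff₀ hπ0]
  nlinarith

/-- **KINETIC FLOOR AT `δ = 1/5`, UNIFORMLY IN THE WIDTH, WITH THE CONSTANT `1/4 - 2U/5 - ε`**: for
every `ε > 0` and window constant `w ≥ 0` there is `M₁` such that for all `U ≥ 0`, all
`M₁ ≤ M ≤ L` and all labellings, every unit window vector `ψ` of the sector `(N_{L,M}(1/5), 0)`
(`Re⟨ψ,H₀ψ⟩ - E(0) ≤ wM/L`) has `(1/4 - 2U/5 - ε)·LM ≤ K(ψ)` — `exists_kineticFloor_uniform` at
the box `(2/3, 3/5)` and `kineticConstant_fifth_ge`. This is hypothesis (i) `KineticFloorAt` of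
`stiffnessOfLandauCriterion` / `tubeStiffness_ge_of_landauWindow` at the doping of the tree's
numerics, positive for `U < 5/8`; what the Landau line of crux `WidthUniformThermodynamics` still
needs is its ★ stub, the Landau criterion on the window. [cite: ScalapinoWhiteZhang1993, §II] -/
theorem exists_kineticFloor_uniform_fifth (ε w : ℝ) (hε : 0 < ε) (hw : 0 ≤ w) :
    ∃ M₁ : ℕ, ∀ (L M : ℕ) [NeZero L] [NeZero M] (Λ : Type) [LinearOrder Λ] [Fintype Λ]
      (e : Λ ≃ ZMod L × ZMod M) (U : ℝ), 0 ≤ U → M₁ ≤ M → M ≤ L →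
      ∀ ψ ∈ szSector (Λ := Λ) (tubeFilling L M (1 / 5)) 0, star ψ ⬝ᵥ ψ = (1 : ℂ) →
        (expect (tubeH0 L M Λ e U) ψ).re - tubeEnergy L M Λ e U 0 (tubeFilling L M (1 / 5)) ≤ w * M / L →
          (1 / 4 - 2 * U / 5 - ε) * ((L : ℝ) * M) ≤
            ∑ a : ZMod L, ∑ b : ZMod M, ∑ σ : Fin 2,
              (expect (creation (orb (e.symm (a, b)) σ) * annihilation (orb (e.symm (a - 1, b)) σ) +
                creation (orb (e.symm (a - 1, b)) σ) * annihilation (orb (e.symm (a, b)) σ)) ψ).re := by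
  obtain ⟨M₁, hM₁⟩ := exists_kineticFloor_uniform (δ := 1 / 5) (α := 2 / 3) (β := 3 / 5) w
    (by norm_num) (by norm_num) (by norm_num) (by norm_num) (by norm_num) (by norm_num) (by norm_num)
    hε hw
  refine ⟨M₁, fun L M _ _ Λ _ _ e U hU hM hML ψ hψ hψ1 hwin => ?_⟩
  have h := hM₁ L M Λ e U hU hM hML ψ hψ hψ1 hwin
  have hk := kineticConstant_fifth_ge
  have hLM : (0 : ℝ) ≤ (L : ℝ) * M := by positivity
  have hle : (1 / 4 - 2 * U / 5 - ε) ≤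
      4 / Real.pi * (3 / 5 * Real.sin (Real.pi * (2 / 3)) + 2 / 3 * Real.sin (Real.pi * (3 / 5))) -
        8 * ((1 - 1 / 5) / 2 - 2 / 3 * (3 / 5)) - 4 / Real.pi * Real.sin (Real.pi * ((1 - 1 / 5) / 2)) -
        U * ((1 - 1 / 5) / 2) - ε := by
    linarith
  exact (mul_le_mul_of_nonneg_right hle hLM).trans h

end Fifth

/-! ### Conjunct (i) of the crux at `δ = 1/5` modulo the ★ window Landau criterion -/

section ModuloStar

open Matrix

/-- **THE WIDTH-UNIFORM STIFFNESS FLOOR AT `δ = 1/5` MODULO THE ★ STUB.** Let `U ≥ 0`, `κ > 0`,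
`s ≥ π/3`, `w ≥ 27`, `ε > 0` with `2U/5 + ε ≤ 1/4`. IF the window Landau criterion of crux idea
`landau-window-yrast` holds at `(U, δ = 1/5, κ, s, w)` for all sizes `M₀ ≤ M ≤ L` and all labellings —
`min(J(ψ)²/(2κLM), s|J(ψ)|/L) ≤ Re⟨ψ,H₀ψ⟩ - E(0)` for every unit vector `ψ` of the sector
`(N_{L,M}(1/5), 0)` with `Re⟨ψ,H₀ψ⟩ - E(0) ≤ wM/L` (`J` the total longitudinal current; this is the
★ stub, NOT claimed here) — THEN conjunct (i) of `WidthUniformThermodynamics` holds at `δ = 1/5` in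
the crux's own shape: `∃ M₁ ∀ M₁ ≤ M ≤ L ∀ labellings, 1/4 - 2U/5 - κ - 2ε ≤ ρ̃_{L,M}(U, 1/5)`.
Composition of `exists_kineticFloor_uniform_fifth` (hypothesis (i) `KineticFloorAt`, proved) with
`tubeStiffness_ge_of_landauWindow` (the reduction, proved); the `k'(π/3L)²/12` correction is absorbed
by `L ≥ ⌈1/ε⌉`. After this theorem the Landau line of crux stmt-16312 has exactly ONE open
hypothesis. [cite: ScalapinoWhiteZhang1993, §II] -/
theorem uniform_stiffnessFloor_fifth_of_landauWindow (U κ s w ε : ℝ) (M₀ : ℕ) (hU : 0 ≤ U)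
    (hκ : 0 < κ) (hs : Real.pi / 3 ≤ s) (hw : 27 ≤ w) (hε : 0 < ε) (hk0 : 2 * U / 5 + ε ≤ 1 / 4)
    (hLC : ∀ (L M : ℕ) [NeZero L] [NeZero M] (Λ : Type) [LinearOrder Λ] [Fintype Λ]
      (e : Λ ≃ ZMod L × ZMod M), M₀ ≤ M → M ≤ L →
      ∀ ψ ∈ szSector (Λ := Λ) (tubeFilling L M (1 / 5)) 0, star ψ ⬝ᵥ ψ = (1 : ℂ) →
        (expect (tubeH0 L M Λ e U) ψ).re - tubeEnergy L M Λ e U 0 (tubeFilling L M (1 / 5)) ≤ w * M / L →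
          min ((∑ a : ZMod L, ∑ b : ZMod M, ∑ σ : Fin 2,
            (expect (creation (orb (e.symm (a, b)) σ) * annihilation (orb (e.symm (a - 1, b)) σ) -
              creation (orb (e.symm (a - 1, b)) σ) * annihilation (orb (e.symm (a, b)) σ)) ψ).im) ^ 2 /
              (2 * κ * ((L : ℝ) * M)))
            (s * |(∑ a : ZMod L, ∑ b : ZMod M, ∑ σ : Fin 2,
              (expect (creation (orb (e.symm (a, b)) σ) * annihilation (orb (e.symm (a - 1, b)) σ) -
                creation (orb (e.symm (a - 1, b)) σ) * annihilation (orb (e.symm (a, b)) σ)) ψ).im)| / L) ≤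
          (expect (tubeH0 L M Λ e U) ψ).re - tubeEnergy L M Λ e U 0 (tubeFilling L M (1 / 5))) :
    ∃ M₁ : ℕ, ∀ (L M : ℕ) [NeZero L] [NeZero M] (Λ : Type) [LinearOrder Λ] [Fintype Λ]
      (e : Λ ≃ ZMod L × ZMod M), M₁ ≤ M → M ≤ L →
        1 / 4 - 2 * U / 5 - κ - 2 * ε ≤ tubeStiffness L M Λ e U (1 / 5) := by
  obtain ⟨M₁, hKF⟩ := exists_kineticFloor_uniform_fifth ε w hε (by linarith)
  refine ⟨M₁ + M₀ + ⌈1 / ε⌉₊ + 3, fun L M _ _ Λ _ _ e hM hML => ?_⟩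
  have hM₁ : M₁ ≤ M := le_trans (by omega) hM
  have hM₀ : M₀ ≤ M := le_trans (by omega) hM
  have hM3 : 3 ≤ M := le_trans (by omega) hM
  have hL3 : 3 ≤ L := hM3.trans hML
  have hcε : ⌈1 / ε⌉₊ ≤ L := (le_trans (by omega) hM).trans hML
  have h := tubeStiffness_ge_of_landauWindow L M Λ e hL3 U (1 / 5) (by norm_num) κ s
    (1 / 4 - 2 * U / 5 - ε) w hκ hs (by linarith) (by linarith) hw (hKF L M Λ e U hU hM₁ hML)
    (hLC L M Λ e hM₀ hML)
  -- absorb the `k'(π/3L)²/12` correction: it is `≤ 1/L ≤ ε`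
  have hL0 : (0 : ℝ) < L := by exact_mod_cast (by omega : 0 < L)
  have hL3r : (3 : ℝ) ≤ L := by exact_mod_cast hL3
  have hLε : 1 / ε ≤ L := (Nat.le_ceil (1 / ε)).trans (by exact_mod_cast hcε)
  have hεL : 1 / (L : ℝ) ≤ ε := by
    rw [div_le_iff₀ hε] at hLε
    rw [div_le_iff₀ hL0]
    linarith
  have hπ := Real.pi_lt_d2
  have hπ0 := Real.pi_pos
  have hx : (Real.pi / 3 / L) ^ 2 / 12 ≤ 1 / L := by
    rw [div_div, div_pow, div_div, div_le_div_iff₀ (by positivity) hL0]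
    have : Real.pi ^ 2 ≤ 10 := by nlinarith
    nlinarith
  have hcorr : (1 / 4 - 2 * U / 5 - ε) * ((Real.pi / 3 / L) ^ 2 / 12) ≤ ε := by
    have h1 : (1 / 4 - 2 * U / 5 - ε) * ((Real.pi / 3 / L) ^ 2 / 12) ≤ 1 * (1 / L) :=
      mul_le_mul (by linarith) hx (by positivity) zero_le_one
    linarith
  have hexp : (1 / 4 - 2 * U / 5 - ε) * (1 - (Real.pi / 3 / L) ^ 2 / 12) =
      (1 / 4 - 2 * U / 5 - ε) - (1 / 4 - 2 * U / 5 - ε) * ((Real.pi / 3 / L) ^ 2 / 12) := by ring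
  rw [hexp] at h
  linarith

end ModuloStar

end Summit.HubbardSuperconductivity.HubbardSuperconductivity.Theorems.WidthHaldane

end
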